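import Summits.RiemannHypothesis.RiemannHypothesis.Theses.RuelleBand
import Summits.RiemannHypothesis.RiemannHypothesis.Theorems.AsymptoticCriticalLine.Negative.BandForms
import Summits.RiemannHypothesis.RiemannHypothesis.Theorems.AsymptoticCriticalLine.Negative.Ladder
import Summits.RiemannHypothesis.RiemannHypothesis.Theorems.AsymptoticCriticalLine.Negative.ShapeFails

/-!
# Line `interior-edge-split` for the crux `RuelleBand.AsymptoticCriticalLine` (stmt-RiemannHypothesis-2063)

Skeleton (crux-plan, round 1, planner `planner-cruxplan-stmt-RiemannHypothesis-2063-interior-edge-split-0`,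
2026-08-16).  Crux ("ACL", `Θ_ess = 1/2`):
`∀ ε > 0, {s | ζ s = 0 ∧ 0 < Re s ∧ Re s < 1 ∧ ε ≤ |Re s − 1/2|}.Finite`.

**The lever (idea card `Ideas/interior-edge-split.md`, triage r1: pass k2, pass k3, fail k1 "glue, not a
lever").**  ACL says that, read along `|Im ρ| → ∞`, the real parts of the zeros accumulate only at `1/2`.
An accumulation point `σ₀ ≠ 1/2` of an infinite `ε`-off family is either INTERIOR (`σ₀ ∈ (0,1) ∖ {1/2}`)
or an EDGE (`σ₀ ∈ {0,1}`); by the symmetry `ρ ↦ 1 − ρ` of the zero set (functional equation, packaged in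
the landed Negative lemma `acl_iff_rightBand`) only the right half `σ₀ ∈ (1/2, 1]` matters.  The two
failure modes have different owners and become the two registered stubs:

* `stub_noRightInteriorBand` — NO BAND IN THE OPEN GAP: every `σ₀ ∈ (1/2,1)` has a neighbourhood
  `|Re s − σ₀| < ε` containing only finitely many zeros.  This is the exact OUTPUT TYPE of every
  essential-spectrum / band mechanism available to route RuelleBand (a weight-window completion of
  Meyer's `H⁰₋` carries essential spectrum on the edge circles `|μ| = e^{±(1/2−a)t₀}`, refuter #3's
  typing constraint (γ); intersecting over windows `a ↓ 0` reaches every interior `σ₀`, never the edge),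
  i.e. the honest landing pad of the route's construction programme `MeyerLasotaYorke` re-posed on the
  three-circle engine (card, Transfer (ii); TRIAGE-r1-2 sharpen).  OPEN, RH-implied, strictly weaker
  than ACL (zeros marching to the 1-line satisfy it).
* `stub_edgeZeroFreeStrip` — A ZERO-FREE VERTICAL STRIP AT THE EDGE: `∃ δ > 0`, no zero with
  `1 − δ < Re s < 1`.  VERBATIM route Strip's rank-2 crux `Strip.StripZeroFreeStrip`
  (stmt-RiemannHypothesis-10660; checked `Iff.rfl` in the planner's scratch file) and verbatim the
  conclusion of this route's support `RuelleBand.AsymptoticToZeroFreeStrip` (stmt-10740): SHARED, staffed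
  once.  OPEN since 1896 (de la Vallée Poussin), RH-implied, strictly weaker than ACL (an interior band
  satisfies it).

**Composition** `AsymptoticCriticalLine_of : stub_noRightInteriorBand → stub_edgeZeroFreeStrip → ACL`
is PROVED below without `sorry` — compactness of `[1/2 + ε, 1 − δ]`: cover it by finitely many of the
finite-zero neighbourhoods of stub 1 (`IsCompact.elim_nhds_subcover`), so the right half-band of level
`ε` is a finite union of finite sets, and `acl_iff_rightBand` (Negative lane) reflects to the left half.
The split LOSES NOTHING: `acl_iff_split : ACL ↔ NoRightInteriorBand ∧ EdgeZeroFreeStrip` (both converse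
halves proved here: `ε := (σ₀ − 1/2)/2`, and the `AsymptoticToZeroFreeStrip` argument
`δ := min (1/4) (1 − max Re ρ)` over the finite level-`1/4` band), and the one-sided stub is the card's
two-sided `NoInteriorBand` up to the functional equation (`noInteriorBand_iff_right`).

**Disproof used** (`Cruxes/AsymptoticCriticalLine/Disproof.lean`, cycles 1–2; landed lane
`Theorems/AsymptoticCriticalLine/Negative/*`, imported above so this check sees them).  There is no kill
(`not_riemannHypothesis_of_not_acl`).  Load-bearing clauses: `acl_false_without_epsPos` (Hardy) is honoured
— `ε > 0` is used exactly where the compact interval `[1/2 + ε, 1 − δ]` is kept inside `(1/2, 1)`, the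
domain of stub 1 (at `ε = 0` it would touch `1/2`, where `not_band_at_other_line` puts infinitely many
zeros); `acl_false_without_rePos` / `_strip` are honoured because both stubs keep the strip clauses
`0 < Re s < 1` and the reflection `acl_iff_rightBand` uses them; `acl_false_without_zero` trivially (both
stubs quantify over zeros).  Neither stub is an instance of a landed Negative lemma: `not_band_at_other_line`
refutes finiteness of the zeros AWAY from `σ₀ ≠ 1/2` (distance `≥ ε`), stub 1 asserts finiteness NEAR
`σ₀` (distance `< ε`); `exists_beurling_not_band` (modulo the catalogued DMV fact) exhibits edge
accumulation `Re ρ → 1` for a Beurling zeta — it profiles stub 2 (integers needed beyond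
`N(x) = κx + O(x^θ)`), it does not refute it for `ζ`; the refuted strengthenings `not_band_shiftedZeta`,
`not_band_swF`, `not_band_zetaTwistedAtTwo`, `not_band_hurwitzFifth`, `not_band_deriv_zeta` concern
other functions.  No stub restates the crux (each is strictly weaker; their conjunction is equivalent).
-/

noncomputable section

set_option linter.dupNamespace false

namespace Summit.RiemannHypothesis.RiemannHypothesis.Cruxes.AsymptoticCriticalLine.InteriorEdgeSplit

open Set Filter Topology
open Summit.RiemannHypothesis.RiemannHypothesis.Theses.RuelleBand (AsymptoticCriticalLine)
open Summit.RiemannHypothesis.RiemannHypothesis.Theorems.AsymptoticCriticalLine.Negative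
  (rightBandSet acl_iff_rightBand)

/-! ## The two stub STATEMENTS (named `Prop`s; the registered `stub_*` theorems below restate them
verbatim, `*_holds` certify the agreement definitionally, and `Registered.stub_*` are the name-keyed
aliases used as the hypotheses of `AsymptoticCriticalLine_of` — the native skeleton audit admits a
hypothesis by the last name component of its head; same device as
`Summits/ABC/ABC/Cruxes/SomeWindowSaving/Lines/inert-box-collapse.lean`). -/

/-- Statement of STUB 1 — NO RIGHT-INTERIOR BAND ("no second band inside the open gap `(1/2, 1)`"):
every abscissa `σ₀` with `1/2 < σ₀ < 1` has a vertical neighbourhood `|Re s − σ₀| < ε` containing only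
finitely many zeros of `ζ` in the open strip.  Equivalently: the real parts of the non-trivial zeros have
no accumulation point in `(1/2, 1)` (nor, by `ρ ↦ 1 − ρ`, in `(0, 1/2)`: `noInteriorBand_iff_right`).
RH-implied; strictly weaker than the crux (zeros with `Re ρ_n → 1` are allowed); not implied by the
Lindelöf hypothesis or by any zero-density theorem (barrier `LindelofBacklund`: densities never give
finiteness); the intended output of a THREE-CIRCLE band engine for the idele-class scaling flow
(`σ_e(T t₀) ⊂ {|μ| = 1} ∪ {|μ| = e^{±(1/2−a)t₀}}` plus one resolvent point per open annulus, for every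
weight window `a ∈ (0, 1/2)`). [idea card interior-edge-split; FaureTsujii2013 = arXiv:1301.5525 Thm 5.1;
Meyer2005 = arXiv:math/0311468 Def. 4.1] -/
def NoRightInteriorBand : Prop :=
  ∀ σ₀ : ℝ, 1 / 2 < σ₀ → σ₀ < 1 →
    ∃ ε : ℝ, 0 < ε ∧
      {s : ℂ | riemannZeta s = 0 ∧ 0 < s.re ∧ s.re < 1 ∧ |s.re - σ₀| < ε}.Finite

/-- Statement of STUB 2 — ZERO-FREE VERTICAL STRIP AT THE EDGE: for some `δ > 0` there is no zero of
`ζ` with `1 − δ < Re s < 1` (quasi-Riemann hypothesis at SOME abscissa `< 1`).  VERBATIM route Strip's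
crux `Summit.RiemannHypothesis.RiemannHypothesis.Theses.Strip.StripZeroFreeStrip`
(stmt-RiemannHypothesis-10660, rank 2 there) and the conclusion of
`RuelleBand.AsymptoticToZeroFreeStrip` (stmt-RiemannHypothesis-10740).  Open since 1896; RH-implied;
strictly weaker than the crux (an interior band is allowed); beyond Landau–Beurling methods
(barrier `BeurlingCounterexamples`, DMV 2006 Thm 1: zeros on `σ = 1 − a/log t`, landed as
`Negative.exists_beurling_not_band`) and beyond Euler-product-free methods (Davenport–Heilbronn).
[Titchmarsh1986 ch. 14; DiamondMontgomeryVorhauer2006 Thm 1; MossinghoffTrudgianYang2024 =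
arXiv:2212.06867 Thm 1.1] -/
def EdgeZeroFreeStrip : Prop :=
  ∃ δ : ℝ, 0 < δ ∧ ∀ s : ℂ, riemannZeta s = 0 → 1 - δ < s.re → s.re < 1 → False

/-! ## The registered stubs (`sorry` lives only in these two theorems) -/

/-- **STUB 1 · `stub_noRightInteriorBand`** (= `NoRightInteriorBand` verbatim) — the INTERIOR half,
load-bearing for route RuelleBand: the landing pad of the construction programme (`MeyerLasotaYorke`
re-posed on the three-circle engine).  OPEN (size XL: RH-implied, no unconditional instance known at
any `σ₀`; a proof at one `σ₀` is already an eventual quasi-RH-type statement on a vertical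
neighbourhood, cf. `Negative.eventually_zeroFree_of_bandSet_finite`). -/
theorem stub_noRightInteriorBand :
    ∀ σ₀ : ℝ, 1 / 2 < σ₀ → σ₀ < 1 →
      ∃ ε : ℝ, 0 < ε ∧
        {s : ℂ | riemannZeta s = 0 ∧ 0 < s.re ∧ s.re < 1 ∧ |s.re - σ₀| < ε}.Finite := by
  sorry

/-- **STUB 2 · `stub_edgeZeroFreeStrip`** (= `EdgeZeroFreeStrip` verbatim = route Strip's
`StripZeroFreeStrip`, stmt-RiemannHypothesis-10660) — the EDGE half, SHARED with route Strip (its typed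
outside toolkits: Mertens power saving ⟺ strip, `StripMertensDictionary`; "beat Vinogradov–Korobov",
`StripBeatVinogradovKorobov`).  OPEN since 1896 (size XL). -/
theorem stub_edgeZeroFreeStrip :
    ∃ δ : ℝ, 0 < δ ∧ ∀ s : ℂ, riemannZeta s = 0 → 1 - δ < s.re → s.re < 1 → False := by
  sorry

/-! ### Consistency: each named statement IS its registered stub (definitionally) -/

theorem noRightInteriorBand_holds : NoRightInteriorBand := stub_noRightInteriorBand
theorem edgeZeroFreeStrip_holds : EdgeZeroFreeStrip := stub_edgeZeroFreeStrip

/-! ### Name-keyed aliases of the two statements (the hypotheses of the composition) -/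
namespace Registered

/-- Alias of `NoRightInteriorBand` keyed by the registered stub name. -/
abbrev stub_noRightInteriorBand : Prop := NoRightInteriorBand
/-- Alias of `EdgeZeroFreeStrip` keyed by the registered stub name. -/
abbrev stub_edgeZeroFreeStrip : Prop := EdgeZeroFreeStrip

end Registered

/-! ## Proved glue (compactness of `[1/2 + ε, 1 − δ]`) -/

/-- Under a zero-free edge strip of width `δ`, every zero of the right half-band of level `ε` has its
real part in the compact interval `[1/2 + ε, 1 − δ]`. -/
theorem re_mem_Icc_of_mem_rightBandSet {δ ε : ℝ}
    (hδ : ∀ s : ℂ, riemannZeta s = 0 → 1 - δ < s.re → s.re < 1 → False)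
    {s : ℂ} (hs : s ∈ rightBandSet ε) : s.re ∈ Icc (1 / 2 + ε) (1 - δ) := by
  obtain ⟨hz, hre, h1⟩ := hs
  refine ⟨hre, ?_⟩
  by_contra h
  exact hδ s hz (not_le.1 h) h1

/-- COMPACTNESS GLUE: no right-interior accumulation and a zero-free edge strip make every right
half-band `{ζ = 0, 1/2 + ε ≤ Re s < 1}` (`ε > 0`) finite — cover `[1/2 + ε, 1 − δ] ⊂ (1/2, 1)` by
finitely many of the finite-zero neighbourhoods (`IsCompact.elim_nhds_subcover`). -/
theorem rightBandSet_finite_of_split (h1 : NoRightInteriorBand) (h2 : EdgeZeroFreeStrip)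
    {ε : ℝ} (hε : 0 < ε) : (rightBandSet ε).Finite := by
  obtain ⟨δ, hδ, hstrip⟩ := h2
  have hKc : IsCompact (Icc (1 / 2 + ε) (1 - δ)) := isCompact_Icc
  have hloc : ∀ x ∈ Icc (1 / 2 + ε) (1 - δ), ∃ r : ℝ, 0 < r ∧
      {s : ℂ | riemannZeta s = 0 ∧ 0 < s.re ∧ s.re < 1 ∧ |s.re - x| < r}.Finite := by
    intro x hx
    exact h1 x (by linarith [hx.1]) (by linarith [hx.2])
  choose! r hr hfin using hloc
  obtain ⟨t, htK, hcover⟩ := hKc.elim_nhds_subcover (fun x => Ioo (x - r x) (x + r x))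
    (fun x hx => Ioo_mem_nhds (by linarith [hr x hx]) (by linarith [hr x hx]))
  refine ((t.finite_toSet).biUnion fun x hx => hfin x (htK x hx)).subset ?_
  intro s hs
  have hsK : s.re ∈ Icc (1 / 2 + ε) (1 - δ) := re_mem_Icc_of_mem_rightBandSet hstrip hs
  obtain ⟨x, hxt, hsx⟩ := mem_iUnion₂.1 (hcover hsK)
  obtain ⟨hz, hre, hlt⟩ := hs
  refine mem_iUnion₂.2 ⟨x, hxt, hz, by linarith, hlt, ?_⟩
  rw [abs_sub_lt_iff]
  exact ⟨by linarith [hsx.2], by linarith [hsx.1]⟩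

/-! ## The composition: the two stubs imply the crux, BY NAME (kernel-checked; no `sorry` below) -/

/-- **`AsymptoticCriticalLine_of`** — the glue of the line: the finite right half-bands
(`rightBandSet_finite_of_split`) give the crux through the one-sided form `acl_iff_rightBand` of the
landed Negative lane (reflection `ρ ↦ 1 − ρ`, Mathlib `riemannZeta_one_sub`). -/
theorem AsymptoticCriticalLine_of (h1 : Registered.stub_noRightInteriorBand)
    (h2 : Registered.stub_edgeZeroFreeStrip) :
    Summit.RiemannHypothesis.RiemannHypothesis.Theses.RuelleBand.AsymptoticCriticalLine :=
  acl_iff_rightBand.2 fun _ hε => rightBandSet_finite_of_split h1 h2 hε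

/-- Wiring check: the registered stubs feed `AsymptoticCriticalLine_of` as stated (the verbatim
restatements are definitionally the named statements). -/
example : Summit.RiemannHypothesis.RiemannHypothesis.Theses.RuelleBand.AsymptoticCriticalLine :=
  AsymptoticCriticalLine_of stub_noRightInteriorBand stub_edgeZeroFreeStrip

/-! ## Honesty: the split loses nothing (both converse halves, sorry-free) -/

/-- ACL ⇒ no right-interior accumulation: around `σ₀ ∈ (1/2, 1)` the neighbourhood of radius
`(σ₀ − 1/2)/2` lies inside the band of that level. -/
theorem noRightInteriorBand_of_acl (h : AsymptoticCriticalLine) : NoRightInteriorBand := by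
  intro σ₀ hσ _
  refine ⟨(σ₀ - 1 / 2) / 2, by linarith, (h ((σ₀ - 1 / 2) / 2) (by linarith)).subset ?_⟩
  rintro s ⟨hz, h0, h1, hs⟩
  rw [abs_sub_lt_iff] at hs
  refine ⟨hz, h0, h1, ?_⟩
  rw [abs_of_pos (by linarith [hs.2])]
  linarith [hs.2]

/-- ACL ⇒ a zero-free edge strip (the argument of the route's support item `AsymptoticToZeroFreeStrip`,
stmt-RiemannHypothesis-10740): the level-`1/4` band `F` is finite; `δ := min (1/4) (1 − max_F Re ρ)`
(`δ := 1/4` if `F = ∅`). -/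
theorem edgeZeroFreeStrip_of_acl (h : AsymptoticCriticalLine) : EdgeZeroFreeStrip := by
  have hF := h (1 / 4) (by norm_num)
  have hmem : ∀ s : ℂ, riemannZeta s = 0 → 3 / 4 < s.re → s.re < 1 →
      s ∈ {s : ℂ | riemannZeta s = 0 ∧ 0 < s.re ∧ s.re < 1 ∧ 1 / 4 ≤ |s.re - 1 / 2|} := by
    intro s hz hlo hhi
    refine ⟨hz, by linarith, hhi, ?_⟩
    rw [abs_of_pos (by linarith)]
    linarith
  by_cases hne : ({s : ℂ | riemannZeta s = 0 ∧ 0 < s.re ∧ s.re < 1 ∧ 1 / 4 ≤ |s.re - 1 / 2|}).Nonempty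
  · obtain ⟨a, haF, hmax⟩ := Set.exists_max_image _ (fun s : ℂ => s.re) hF hne
    obtain ⟨-, -, ha1, -⟩ := haF
    refine ⟨min (1 / 4) (1 - a.re), lt_min (by norm_num) (by linarith), fun s hz hlo hhi => ?_⟩
    have hm1 := min_le_left (1 / 4 : ℝ) (1 - a.re)
    have hm2 := min_le_right (1 / 4 : ℝ) (1 - a.re)
    have hsa : s.re ≤ a.re := hmax s (hmem s hz (by linarith) hhi)
    linarith
  · exact ⟨1 / 4, by norm_num, fun s hz hlo hhi => hne ⟨s, hmem s hz (by linarith) hhi⟩⟩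

/-- THE SPLIT IS LOSSLESS: `ACL ⟺ NoRightInteriorBand ∧ EdgeZeroFreeStrip` (each conjunct strictly
weaker, the conjunction equivalent — so neither stub is the crux in costume, and refuters get two
independent `¬`-targets: "a genuine second band at some `σ₀ ∈ (1/2,1)`" vs "zeros marching to the
1-line"). -/
theorem acl_iff_split : AsymptoticCriticalLine ↔ (NoRightInteriorBand ∧ EdgeZeroFreeStrip) :=
  ⟨fun h => ⟨noRightInteriorBand_of_acl h, edgeZeroFreeStrip_of_acl h⟩,
    fun h => AsymptoticCriticalLine_of h.1 h.2⟩

/-! ## The card's two-sided statement is the one-sided stub (functional equation) -/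

/-- The idea card's `NoInteriorBand`: no accumulation of real parts at ANY interior abscissa
`σ₀ ∈ (0,1)`, `σ₀ ≠ 1/2`. -/
def NoInteriorBand : Prop :=
  ∀ σ₀ : ℝ, 0 < σ₀ → σ₀ < 1 → σ₀ ≠ 1 / 2 →
    ∃ ε : ℝ, 0 < ε ∧
      {s : ℂ | riemannZeta s = 0 ∧ 0 < s.re ∧ s.re < 1 ∧ |s.re - σ₀| < ε}.Finite

/-- `NoInteriorBand ⟺ NoRightInteriorBand`: the left half follows from the right half by the
reflection `s ↦ 1 − s` of the zeros of the open strip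
(`Literature.NumberTheory.LFunctions.GeneralizedRH.riemannZeta_one_sub_eq_zero`, from Mathlib
`riemannZeta_one_sub`). -/
theorem noInteriorBand_iff_right : NoInteriorBand ↔ NoRightInteriorBand := by
  refine ⟨fun h σ₀ hσ hσ1 => h σ₀ (by linarith) hσ1 hσ.ne', fun h σ₀ h0 h1 hne => ?_⟩
  rcases lt_or_gt_of_ne hne with hlt | hgt
  · -- left interior point: reflect the finite neighbourhood of `1 - σ₀ ∈ (1/2, 1)`
    obtain ⟨ε, hε, hfin⟩ := h (1 - σ₀) (by linarith) (by linarith)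
    refine ⟨ε, hε, (hfin.image fun s : ℂ => 1 - s).subset ?_⟩
    rintro s ⟨hz, hs0, hs1, hs⟩
    refine ⟨1 - s, ⟨?_, ?_, ?_, ?_⟩, sub_sub_cancel 1 s⟩
    · exact Literature.NumberTheory.LFunctions.GeneralizedRH.riemannZeta_one_sub_eq_zero hz hs0 hs1
    · simp only [Complex.sub_re, Complex.one_re]; linarith
    · simp only [Complex.sub_re, Complex.one_re]; linarith
    · simp only [Complex.sub_re, Complex.one_re]
      rw [abs_sub_lt_iff] at hs ⊢
      exact ⟨by linarith [hs.2], by linarith [hs.1]⟩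
  · exact h σ₀ hgt h1

end Summit.RiemannHypothesis.RiemannHypothesis.Cruxes.AsymptoticCriticalLine.InteriorEdgeSplit

end
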